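/-
Copyright (c) 2026 the pub-hodgecm-mathlib formalisation cell (harness21).  Prover seat hodgecm-mathlib-K2E3-p23 (g3), Track B «K2-LIT» ∕ h413
(`stmt-HodgeConjecture-24833`), line `K2_E3_EllipticInputs`, 13a road A (line lead K2E3-p10 (g3)), item (D3) «Witt–Cartan, K₀-group currency, normalised
kernel», file G2.  2026-09-04.
-/
import Summits.HodgeConjecture.HodgeConjecture.Theorems.K2E3WittCartanPivot      -- G1 (this seat): pivot tools
import HarnessLib

/-!
# Crux `H413` — K2-LIT E3 «EllipticInputs», 13a road A, item (D3) G2: THE ELIMINATION STEP of the Cartan decomposition of `U(σ, W)` (`W = wittFormOn e Han`,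
# normalised anisotropic kernel, any `m`) — from a hyperbolic pivot `|q_{st}| = M` inside the frame `S_k` to the next eigen-pair at the positions `k`, `rev k`

Cell `hodgecm-mathlib`, Track B «K2-LIT», crux item `stmt-HodgeConjecture-24833` (h413), socket U12-g ‹13a› road A.  Item (D3), file G2 (G1 = ★ `K2E3WittCartanPivot`;
G3 = the frame induction and the letter `hrawW`).  This is p09's ★ p856681 `exists_conj_eigen_of_pivot` (`J₀`) in `W`-currency, with the Eichler moves of ★ F2a
`K2E3WittIntegralMoves` (which FIX every `e_l` off the frame, so the eigen-pairs already produced survive) and the kernel-fixing `rev`-commuting permutations of ★ F2a.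

SETTING as in ★ F1–F3, G1.  The frames: `S_k = {a : Fin N | k ≤ a.val ∧ a.val + k < N}` (`rev`-stable; contains the kernel positions for `k ≤ r`; its complement
`{e_0, …, e_{k−1}, f_0, …, f_{k−1}}` is hyperbolic).

* §1 frames and bounds: `mem_frameSet_iff`, `rev_mem_frameSet`, `kernel_mem_frameSet`, `hyperbolic_of_not_mem_frameSet`, `pos_mem_frameSet`,
  `frameSet_succ_subset`, `eq_or_eq_of_mem_frameSet_of_not_mem_succ`; `v_mulVec_apply_le_of_columns` (an integral matrix does not increase the sup norm),
  `v_mulVec_apply_le_of_frame` (a matrix bounded by `M` on `S × S` maps `𝒪^N ∩ K^S` to vectors bounded by `M` on `S`); `lineRoot_mulVec_single_rev` (the Eichler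
  move at `j` fixes `e_{rev j}`, the vector of its line).
* §2 **`exists_conj_eigen_of_pivot_witt`**: `q ∈ U(σ, W)` with every `e_a`, `a ∉ S_k`, an eigenvector, entries of `q`, `q⁻¹` on `S_k × S_k` bounded by `M`, `|q_{st}| = M ≠ 0`
  at HYPERBOLIC `s, t ∈ S_k`, `k < r`: there are `k₁, k₂ ∈ K₀` fixing every `e_a`, `a ∉ S_k`, mapping `K^{S_k}` to itself, with `q′ = k₁ q k₂` satisfying
  `q′ e_k = (σ q_{st})⁻¹ e_k`, `q′ e_{rev k} = q_{st} e_{rev k}` (`k` = the position `⟨k⟩`), and entries of `q′`, `q′⁻¹` on `S_k × S_k` still bounded by `M`.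

`--supports stmt-HodgeConjecture-24833 --as helper`.  THEOREMS ONLY — no `def`, no named fact, no instance, no notation, no `sorry`.  HONEST LABEL: HC_CM is
proved only modulo the 7 printed citations (2 remaining named inputs: hLiu418 = stmt-HodgeConjecture-24832, h413 = stmt-HodgeConjecture-24833) until rung 0
closes; unconditional local algebra, closes no organ by itself.

References: [BruhatTits1972] F. Bruhat, J. Tits, Publ. Math. IHÉS 41 (1972), (4.4.3) · [Tits1979] J. Tits, PSPM 33.1 (1979), §3.3.3 · [Macdonald1995] I. G.
Macdonald, *Symmetric Functions and Hall Polynomials* (1995), Ch. V §2 · [Dieudonne1971GroupesClassiques] J. Dieudonné (1971), Chap. II §5 · [Jacobowitz1962]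
R. Jacobowitz, Amer. J. Math. 84 (1962), §7.
-/

set_option autoImplicit false
-- the mandated namespace repeats `HodgeConjecture.HodgeConjecture`, as in every `Theorems/*.lean` of this sub-problem
set_option linter.dupNamespace false

noncomputable section

open scoped Matrix MatrixGroups Valued WithZero
open Matrix

namespace Summit.HodgeConjecture.HodgeConjecture.Cruxes.H413.K2E3WittCartanStep

open Literature.NumberTheory.Automorphic Literature.NumberTheory.Automorphic.UnitaryGroup Literature.NumberTheory.Automorphic.HermitianLattice
open K2E3LocalUnitaryWitt K2E3WittCartanUnramified K2E3WittParabolicBlocks K2E3WittHermFormStd K2E3WittIntegralMoves K2E3WittIntegralTransitive K2E3WittIwasawa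
  K2E3WittCartanPivot

/-! ## §1 The frames `S_k`, valuation bounds, and the line vector of an Eichler move -/

section Frames

variable {N r m : ℕ} (e : WittIndex r m ≃ Fin N)
  (hstd : ∀ x, (e x).val = Sum.elim (fun i : Fin r => i.val) (Sum.elim (fun u : Fin m => r + u.val) (fun j : Fin r => r + m + j.val)) x)

/-- Membership in the frame `S_k = {a | k ≤ a ∧ a + k < N}`. [cite: BruhatTits1972, (4.4.3)] -/
theorem mem_frameSet_iff (k : ℕ) (a : Fin N) : a ∈ (Finset.univ.filter fun a : Fin N => k ≤ a.val ∧ a.val + k < N) ↔ k ≤ a.val ∧ a.val + k < N := by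
  simp only [Finset.mem_filter, Finset.mem_univ, true_and]

/-- `S_k` is `rev`-stable. [cite: BruhatTits1972, (4.4.3)] -/
theorem rev_mem_frameSet (k : ℕ) (a : Fin N) (ha : a ∈ (Finset.univ.filter fun a : Fin N => k ≤ a.val ∧ a.val + k < N)) :
    Fin.rev a ∈ (Finset.univ.filter fun a : Fin N => k ≤ a.val ∧ a.val + k < N) := by
  rw [mem_frameSet_iff] at ha ⊢; have := a.isLt; rw [Fin.val_rev]; omega

include e in
/-- The kernel positions lie in `S_k` for `k ≤ r`. [cite: BruhatTits1972, (4.4.3)] -/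
theorem kernel_mem_frameSet {k : ℕ} (hk : k ≤ r) (a : Fin N) (h₁ : r ≤ a.val) (h₂ : a.val < r + m) :
    a ∈ (Finset.univ.filter fun a : Fin N => k ≤ a.val ∧ a.val + k < N) := by
  rw [mem_frameSet_iff]; have := card_eq e; omega

include e in
/-- A position off `S_k` (`k ≤ r`) is hyperbolic. [cite: BruhatTits1972, (4.4.3)] -/
theorem hyperbolic_of_not_mem_frameSet {k : ℕ} (hk : k ≤ r) (a : Fin N) (ha : a ∉ (Finset.univ.filter fun a : Fin N => k ≤ a.val ∧ a.val + k < N)) :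
    a.val < r ∨ r + m ≤ a.val := by
  rw [mem_frameSet_iff] at ha; have := card_eq e; omega

include e in
/-- The position `k` lies in `S_k` and is hyperbolic, for `k < r`. [cite: BruhatTits1972, (4.4.3)] -/
theorem pos_mem_frameSet {k : ℕ} (hk : k < r) :
    (⟨k, by have := card_eq e; omega⟩ : Fin N) ∈ (Finset.univ.filter fun a : Fin N => k ≤ a.val ∧ a.val + k < N) := by
  rw [mem_frameSet_iff]; have := card_eq e; dsimp only; omega

/-- `S_{k+1} ⊆ S_k`. [cite: BruhatTits1972, (4.4.3)] -/
theorem frameSet_succ_subset (k : ℕ) :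
    (Finset.univ.filter fun a : Fin N => k + 1 ≤ a.val ∧ a.val + (k + 1) < N) ⊆ (Finset.univ.filter fun a : Fin N => k ≤ a.val ∧ a.val + k < N) := by
  intro a ha; rw [mem_frameSet_iff] at ha ⊢; omega

/-- `S_k ∖ S_{k+1} = {k, rev k}`. [cite: BruhatTits1972, (4.4.3)] -/
theorem eq_or_eq_of_mem_frameSet_of_not_mem_succ {k : ℕ} (a : Fin N) (ha : a ∈ (Finset.univ.filter fun a : Fin N => k ≤ a.val ∧ a.val + k < N))
    (ha' : a ∉ (Finset.univ.filter fun a : Fin N => k + 1 ≤ a.val ∧ a.val + (k + 1) < N)) (hk : k < N) :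
    a = ⟨k, hk⟩ ∨ a = Fin.rev ⟨k, hk⟩ := by
  rw [mem_frameSet_iff] at ha ha'
  have := a.isLt
  rcases Nat.lt_or_ge a.val (k + 1) with h | h
  · exact Or.inl (Fin.ext (by dsimp only; omega))
  · exact Or.inr (Fin.ext (by rw [Fin.val_rev]; dsimp only; omega))

end Frames

section Bounds

variable {K : Type*} [Field K] [Valued K ℤᵐ⁰] {N : ℕ}

/-- **An integral matrix does not increase the sup norm**: `|A_{ij}| ≤ 1`, `|w_j| ≤ M` ⇒ `|(A w)_i| ≤ M`. [cite: Macdonald1995, Ch. V §2] -/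
theorem v_mulVec_apply_le_of_columns {A : Matrix (Fin N) (Fin N) K} (hA : ∀ i j, Valued.v (A i j) ≤ 1) {w : Fin N → K} {M : ℤᵐ⁰} (hw : ∀ j, Valued.v (w j) ≤ M)
    (i : Fin N) : Valued.v ((A *ᵥ w) i) ≤ M := by
  rw [Matrix.mulVec, dotProduct]
  refine Valuation.map_sum_le _ fun j _ => ?_
  rw [map_mul]
  calc Valued.v (A i j) * Valued.v (w j) ≤ 1 * M := mul_le_mul' (hA i j) (hw j)
    _ = M := one_mul M

/-- **A matrix bounded by `M` on `S × S` maps `𝒪^N ∩ K^S` to vectors bounded by `M` on `S`.** [cite: Macdonald1995, Ch. V §2] -/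
theorem v_mulVec_apply_le_of_frame {Q : Matrix (Fin N) (Fin N) K} {S : Finset (Fin N)} {M : ℤᵐ⁰} (hQ : ∀ a ∈ S, ∀ b ∈ S, Valued.v (Q a b) ≤ M)
    {z : Fin N → K} (hzS : z ∈ frame K N S) (hzL : z ∈ stdLattice K N) {a : Fin N} (ha : a ∈ S) : Valued.v ((Q *ᵥ z) a) ≤ M := by
  rw [Matrix.mulVec, dotProduct]
  refine Valuation.map_sum_le _ fun b _ => ?_
  by_cases hb : b ∈ S
  · rw [map_mul]
    calc Valued.v (Q a b) * Valued.v (z b) ≤ M * 1 := mul_le_mul' (hQ a ha b hb) (hzL b)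
      _ = M := mul_one M
  · rw [hzS b hb, mul_zero, map_zero]; exact zero_le

/-- A vector in `K^S` bounded by `M` on `S` is bounded by `M` everywhere. [folklore] -/
theorem v_apply_le_of_frame {S : Finset (Fin N)} {M : ℤᵐ⁰} {z : Fin N → K} (hzS : z ∈ frame K N S) (hz : ∀ a ∈ S, Valued.v (z a) ≤ M) (a : Fin N) :
    Valued.v (z a) ≤ M := by
  by_cases ha : a ∈ S
  · exact hz a ha
  · rw [hzS a ha, map_zero]; exact zero_le

/-- **The `S × S` entries of `X · Y · Z` are bounded by `M`** when `X` is integral, `Y` is bounded by `M` on `S × S` and maps `K^S` into itself, and the columns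
`Z e_b` (`b ∈ S`) lie in `𝒪^N ∩ K^S`. [cite: Macdonald1995, Ch. V §2] -/
theorem v_mul_mul_apply_le {X Y Z : Matrix (Fin N) (Fin N) K} {S : Finset (Fin N)} {M : ℤᵐ⁰} (hX : ∀ i j, Valued.v (X i j) ≤ 1)
    (hY : ∀ a ∈ S, ∀ b ∈ S, Valued.v (Y a b) ≤ M) (hYS : ∀ v ∈ frame K N S, Y *ᵥ v ∈ frame K N S)
    (hZL : ∀ b ∈ S, Z *ᵥ Pi.single b 1 ∈ stdLattice K N) (hZS : ∀ b ∈ S, Z *ᵥ Pi.single b 1 ∈ frame K N S) {a b : Fin N} (hb : b ∈ S) :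
    Valued.v ((X * Y * Z) a b) ≤ M := by
  rw [apply_eq_mulVec_single (X * Y * Z) a b, ← Matrix.mulVec_mulVec, ← Matrix.mulVec_mulVec]
  refine v_mulVec_apply_le_of_columns hX (fun j => ?_) a
  exact v_apply_le_of_frame (hYS _ (hZS b hb)) (fun a' ha' => v_mulVec_apply_le_of_frame hY (hZS b hb) (hZL b hb) ha') j

end Bounds

section Eichler

variable {K : Type*} [Field K] (σ : K →+* K) {N r m : ℕ} (e : WittIndex r m ≃ Fin N)
  (hstd : ∀ x, (e x).val = Sum.elim (fun i : Fin r => i.val) (Sum.elim (fun u : Fin m => r + u.val) (fun j : Fin r => r + m + j.val)) x)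
  (Han : Matrix (Fin m) (Fin m) K)

include hstd in
/-- **The Eichler move at `j` fixes the vector `e_{rev j}` of its line** (★ `lineRoot_mulVec_self`). [cite: Dieudonne1971GroupesClassiques, Chap. II §5] -/
theorem lineRoot_mulVec_single_rev {j : Fin N} (hj : j.val < r ∨ r + m ≤ j.val) {x' : Fin N → K} (hx'1 : x' j = 1) (z : K) :
    lineRoot σ (wittFormOn e Han) (Pi.single (Fin.rev j) 1) (x' - Pi.single j 1) z *ᵥ Pi.single (Fin.rev j) 1 = Pi.single (Fin.rev j) 1 :=
  lineRoot_mulVec_self σ _ z (eichler_orth σ e hstd Han hj hx'1).1 (eichler_orth σ e hstd Han hj hx'1).2.1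

/-- `k u = w ⇒ k⁻¹ w = u` for `k ∈ U` (matrix form). [folklore] -/
theorem inv_mulVec_of_mulVec_eq {H : Matrix (Fin N) (Fin N) K} (k : unitaryGroupOfForm σ H) {u w : Fin N → K}
    (h : ((k : GL (Fin N) K) : Matrix (Fin N) (Fin N) K) *ᵥ u = w) : (((k : GL (Fin N) K)⁻¹ : GL (Fin N) K) : Matrix (Fin N) (Fin N) K) *ᵥ w = u := by
  rw [← h, inv_mulVec_mulVec]

/-- `τ⁻¹` commutes with `rev` when `τ` does. [folklore] -/
theorem perm_symm_rev {τ : Equiv.Perm (Fin N)} (hτ : ∀ i, τ (Fin.rev i) = Fin.rev (τ i)) (i : Fin N) : τ.symm (Fin.rev i) = Fin.rev (τ.symm i) := by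
  apply τ.injective; rw [Equiv.apply_symm_apply, hτ, Equiv.apply_symm_apply]

end Eichler

/-! ## §2 The elimination step -/

section Step

variable {K : Type*} [Field K] [Valued K ℤᵐ⁰] (σ : K →+* K) {N r m : ℕ} (e : WittIndex r m ≃ Fin N)
  (hstd : ∀ x, (e x).val = Sum.elim (fun i : Fin r => i.val) (Sum.elim (fun u : Fin m => r + u.val) (fun j : Fin r => r + m + j.val)) x)
  (Han : Matrix (Fin m) (Fin m) K)

include hstd in
/-- **THE ELIMINATION STEP OF THE CARTAN DECOMPOSITION OF `U(σ, W)` (normalised anisotropic kernel, any `m`).**  Let `k < r`, `S = S_k`, `q ∈ U(σ, W)` with every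
`e_a` (`a ∉ S`) an eigenvector, entries of `q` and `q⁻¹` on `S × S` bounded by `M ≠ 0`, and `|q_{st}| = M` at HYPERBOLIC `s, t ∈ S`.  Then there are `k₁, k₂ ∈ K₀`
fixing every `e_a`, `a ∉ S`, and mapping `K^S` into itself, such that `q′ = k₁ q k₂` has `q′ e_k = (σ q_{st})⁻¹ e_k` and `q′ e_{rev k} = q_{st} e_{rev k}` and the
entries of `q′`, `q′⁻¹` on `S × S` are still bounded by `M`.  Construction (p09's ★ p856681 step with the kernel): `ẽ = q_{st}⁻¹ q e_t ∈ 𝒪^N ∩ K^S` (isotropic,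
`ẽ_s = 1`) and `x₂ = (σ q_{st})⁻¹ q⁻¹ e_{rev s} ∈ 𝒪^N ∩ K^S` (isotropic, `(x₂)_{rev t} = 1` by ★ G1 `inv_apply_of_hyperbolic`) give the Eichler moves `T₁ : e_s ↦ ẽ`,
`T₂ : e_{rev t} ↦ x₂` of ★ F2a; `T₁⁻¹ q T₂` maps `e_t ↦ q_{st} e_s`, `e_{rev t} ↦ (σ q_{st})⁻¹ e_{rev s}`; two kernel-fixing `rev`-commuting permutations supported in `S`
(★ `exists_perm_comm_rev_apply_eq`) move `rev s ↦ k`, `rev t ↦ k`. [cite: BruhatTits1972, (4.4.3)] [cite: Tits1979, §3.3.3] [cite: Macdonald1995, Ch. V §2] -/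
theorem exists_conj_eigen_of_pivot_witt (hσ : ∀ a, σ (σ a) = a) (hvσ : ∀ a, Valued.v (σ a) = Valued.v a) (hHan : (Han.map σ)ᵀ = Han)
    (hint : ∀ u u', Valued.v (Han u u') ≤ 1) {k : ℕ} (hk : k < r) (q : unitaryGroupOfForm σ (wittFormOn e Han))
    (heig : ∀ a : Fin N, a ∉ (Finset.univ.filter fun a : Fin N => k ≤ a.val ∧ a.val + k < N) →
      ∃ c : K, ((q : GL (Fin N) K) : Matrix (Fin N) (Fin N) K) *ᵥ Pi.single a 1 = c • Pi.single a 1)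
    {M : ℤᵐ⁰} (hM0 : M ≠ 0)
    (hle : ∀ a ∈ (Finset.univ.filter fun a : Fin N => k ≤ a.val ∧ a.val + k < N), ∀ b ∈ (Finset.univ.filter fun a : Fin N => k ≤ a.val ∧ a.val + k < N),
      Valued.v (((q : GL (Fin N) K) : Matrix (Fin N) (Fin N) K) a b) ≤ M ∧ Valued.v ((((q : GL (Fin N) K)⁻¹ : GL (Fin N) K) : Matrix (Fin N) (Fin N) K) a b) ≤ M)
    {s t : Fin N} (hsS : s ∈ (Finset.univ.filter fun a : Fin N => k ≤ a.val ∧ a.val + k < N))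
    (htS : t ∈ (Finset.univ.filter fun a : Fin N => k ≤ a.val ∧ a.val + k < N)) (hs : s.val < r ∨ r + m ≤ s.val) (ht : t.val < r ∨ r + m ≤ t.val)
    (hst : Valued.v (((q : GL (Fin N) K) : Matrix (Fin N) (Fin N) K) s t) = M) :
    ∃ k₁ k₂ : unitaryGroupOfForm σ (wittFormOn e Han), k₁ ∈ unitaryInt σ (wittFormOn e Han) ∧ k₂ ∈ unitaryInt σ (wittFormOn e Han) ∧
      (∀ a : Fin N, a ∉ (Finset.univ.filter fun a : Fin N => k ≤ a.val ∧ a.val + k < N) →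
        ((k₁ : GL (Fin N) K) : Matrix (Fin N) (Fin N) K) *ᵥ Pi.single a 1 = Pi.single a 1 ∧ ((k₂ : GL (Fin N) K) : Matrix (Fin N) (Fin N) K) *ᵥ Pi.single a 1 = Pi.single a 1) ∧
      (((k₁ * q * k₂ : unitaryGroupOfForm σ (wittFormOn e Han)) : GL (Fin N) K) : Matrix (Fin N) (Fin N) K) *ᵥ Pi.single ⟨k, by have := card_eq e; omega⟩ 1 =
        (σ (((q : GL (Fin N) K) : Matrix (Fin N) (Fin N) K) s t))⁻¹ • Pi.single ⟨k, by have := card_eq e; omega⟩ 1 ∧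
      (((k₁ * q * k₂ : unitaryGroupOfForm σ (wittFormOn e Han)) : GL (Fin N) K) : Matrix (Fin N) (Fin N) K) *ᵥ Pi.single (Fin.rev ⟨k, by have := card_eq e; omega⟩) 1 =
        ((q : GL (Fin N) K) : Matrix (Fin N) (Fin N) K) s t • Pi.single (Fin.rev ⟨k, by have := card_eq e; omega⟩) 1 ∧
      (∀ a ∈ (Finset.univ.filter fun a : Fin N => k ≤ a.val ∧ a.val + k < N), ∀ b ∈ (Finset.univ.filter fun a : Fin N => k ≤ a.val ∧ a.val + k < N),
        Valued.v ((((k₁ * q * k₂ : unitaryGroupOfForm σ (wittFormOn e Han)) : GL (Fin N) K) : Matrix (Fin N) (Fin N) K) a b) ≤ M ∧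
        Valued.v (((((k₁ * q * k₂ : unitaryGroupOfForm σ (wittFormOn e Han)) : GL (Fin N) K)⁻¹ : GL (Fin N) K) : Matrix (Fin N) (Fin N) K) a b) ≤ M) := by
  have hN : N = r + (m + r) := card_eq e
  set S : Finset (Fin N) := Finset.univ.filter fun a : Fin N => k ≤ a.val ∧ a.val + k < N with hSdef
  set p : Fin N := ⟨k, by omega⟩ with hpdef
  have hS : ∀ i ∈ S, Fin.rev i ∈ S := rev_mem_frameSet k
  have hSc : ∀ a : Fin N, a ∉ S → (a.val < r ∨ r + m ≤ a.val) := hyperbolic_of_not_mem_frameSet e hk.le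
  have hSk : ∀ a : Fin N, r ≤ a.val → a.val < r + m → a ∈ S := kernel_mem_frameSet e hk.le
  have hpS : p ∈ S := pos_mem_frameSet e hk
  have hph : p.val < r ∨ r + m ≤ p.val := Or.inl hk
  have hrpS : Fin.rev p ∈ S := hS p hpS
  have hrsS : Fin.rev s ∈ S := hS s hsS
  have hrtS : Fin.rev t ∈ S := hS t htS
  have hrs : (Fin.rev s).val < r ∨ r + m ≤ (Fin.rev s).val := rev_hyperbolic e hs
  have hrt : (Fin.rev t).val < r ∨ r + m ≤ (Fin.rev t).val := rev_hyperbolic e ht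
  set A : Matrix (Fin N) (Fin N) K := ((q : GL (Fin N) K) : Matrix (Fin N) (Fin N) K) with hA
  set Ai : Matrix (Fin N) (Fin N) K := (((q : GL (Fin N) K)⁻¹ : GL (Fin N) K) : Matrix (Fin N) (Fin N) K) with hAi
  set lam : K := A s t with hlam
  have hlam0 : lam ≠ 0 := fun h => hM0 (by rw [← hst, h, map_zero])
  have hσlam0 : σ lam ≠ 0 := (map_ne_zero σ).2 hlam0
  -- frame stability of `q` and `q⁻¹`
  have heig' : ∀ a : Fin N, a ∉ S → ∃ c : K, Ai *ᵥ Pi.single a 1 = c • Pi.single a 1 := fun a ha => by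
    obtain ⟨c, hc⟩ := heig a ha; exact ⟨c⁻¹, inv_mulVec_single_of_eigen σ q hc⟩
  have hqS : ∀ {v : Fin N → K}, v ∈ frame K N S → A *ᵥ v ∈ frame K N S := fun hv => mulVec_mem_frame_of_eigen σ e hstd Han q hS hSc heig hv
  have hqiS : ∀ {v : Fin N → K}, v ∈ frame K N S → Ai *ᵥ v ∈ frame K N S := fun {v} hv => by
    have h := mulVec_mem_frame_of_eigen σ e hstd Han q⁻¹ hS hSc (fun a ha => by rw [Subgroup.coe_inv]; exact heig' a ha) hv
    rwa [Subgroup.coe_inv] at h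
  -- `ẽ = λ⁻¹ q e_t`
  set et : Fin N → K := lam⁻¹ • (A *ᵥ Pi.single t 1) with het
  have het_a : ∀ a, et a = lam⁻¹ * A a t := fun a => by rw [het, Pi.smul_apply, smul_eq_mul, ← apply_eq_mulVec_single]
  have het_s : et s = 1 := by rw [het_a, ← hlam, inv_mul_cancel₀ hlam0]
  have hetS : et ∈ frame K N S := Submodule.smul_mem _ _ (hqS (single_mem_frame htS))
  have hetL : et ∈ stdLattice K N := fun a => by
    refine v_apply_le_of_frame hetS (fun a ha => ?_) a
    rw [het_a, map_mul, map_inv₀, hst]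
    calc M⁻¹ * Valued.v (A a t) ≤ M⁻¹ * M := mul_le_mul' le_rfl (hle a ha t htS).1
      _ = 1 := inv_mul_cancel₀ hM0
  have het0 : hermForm σ (wittFormOn e Han) et et = 0 := by
    rw [het]; refine hermForm_smul_smul_self_eq_zero σ _ ?_ _
    rw [hermForm_mulVec_mulVec]; exact hermForm_witt_single_single_of_hyperbolic σ e hstd Han ht
  have hAet : A *ᵥ Pi.single t 1 = lam • et := by rw [het, smul_smul, mul_inv_cancel₀ hlam0, one_smul]
  -- `x₂ = (σλ)⁻¹ q⁻¹ e_{rev s}`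
  set x2 : Fin N → K := (σ lam)⁻¹ • (Ai *ᵥ Pi.single (Fin.rev s) 1) with hx2
  have hx2_a : ∀ a, x2 a = (σ lam)⁻¹ * Ai a (Fin.rev s) := fun a => by rw [hx2, Pi.smul_apply, smul_eq_mul, ← apply_eq_mulVec_single]
  have hx2_1 : x2 (Fin.rev t) = 1 := by
    rw [hx2_a, hAi, inv_apply_of_hyperbolic σ e hstd Han q hrt hrs, Fin.rev_rev, Fin.rev_rev, ← hA, ← hlam, inv_mul_cancel₀ hσlam0]
  have hx2S : x2 ∈ frame K N S := Submodule.smul_mem _ _ (hqiS (single_mem_frame hrsS))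
  have hx2L : x2 ∈ stdLattice K N := fun a => by
    refine v_apply_le_of_frame hx2S (fun a ha => ?_) a
    rw [hx2_a, map_mul, map_inv₀, hvσ, hst]
    calc M⁻¹ * Valued.v (Ai a (Fin.rev s)) ≤ M⁻¹ * M := mul_le_mul' le_rfl (hle a ha _ hrsS).2
      _ = 1 := inv_mul_cancel₀ hM0
  have hx20 : hermForm σ (wittFormOn e Han) x2 x2 = 0 := by
    rw [hx2]; refine hermForm_smul_smul_self_eq_zero σ _ ?_ _
    have h := hermForm_mulVec_mulVec q⁻¹ (Pi.single (Fin.rev s) (1 : K)) (Pi.single (Fin.rev s) 1)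
    rw [Subgroup.coe_inv] at h
    rw [h]; exact hermForm_witt_single_single_of_hyperbolic σ e hstd Han hrs
  have hAx2 : A *ᵥ x2 = (σ lam)⁻¹ • Pi.single (Fin.rev s) 1 := by rw [hx2, Matrix.mulVec_smul, hA, hAi, mulVec_inv_mulVec]
  -- the Eichler moves `T₁ : e_s ↦ ẽ` and `T₂ : e_{rev t} ↦ x₂`
  set T₁ : unitaryGroupOfForm σ (wittFormOn e Han) := ⟨_, lineRootGL_mem_unitary_witt σ e hstd Han hσ hHan hs het_s het0⟩ with hT₁
  set T₂ : unitaryGroupOfForm σ (wittFormOn e Han) := ⟨_, lineRootGL_mem_unitary_witt σ e hstd Han hσ hHan hrt hx2_1 hx20⟩ with hT₂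
  have hT₁K : T₁ ∈ unitaryInt σ (wittFormOn e Han) := lineRootGL_mem_unitaryInt_witt σ e hstd Han hσ hvσ hHan hint hs hetL het_s het0
  have hT₂K : T₂ ∈ unitaryInt σ (wittFormOn e Han) := lineRootGL_mem_unitaryInt_witt σ e hstd Han hσ hvσ hHan hint hrt hx2L hx2_1 hx20
  have hT₁s : ((T₁ : GL (Fin N) K) : Matrix (Fin N) (Fin N) K) *ᵥ Pi.single s 1 = et := lineRoot_mulVec_single_self σ e hstd Han hs et
  have hT₁rs : ((T₁ : GL (Fin N) K) : Matrix (Fin N) (Fin N) K) *ᵥ Pi.single (Fin.rev s) 1 = Pi.single (Fin.rev s) 1 :=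
    lineRoot_mulVec_single_rev σ e hstd Han hs het_s _
  have hT₂rt : ((T₂ : GL (Fin N) K) : Matrix (Fin N) (Fin N) K) *ᵥ Pi.single (Fin.rev t) 1 = x2 := lineRoot_mulVec_single_self σ e hstd Han hrt x2
  have hT₂t : ((T₂ : GL (Fin N) K) : Matrix (Fin N) (Fin N) K) *ᵥ Pi.single t 1 = Pi.single t 1 := by
    have h := lineRoot_mulVec_single_rev σ e hstd Han hrt hx2_1 (σ (x2 (Fin.rev (Fin.rev t))))
    rw [show (Pi.single t (1 : K) : Fin N → K) = Pi.single (Fin.rev (Fin.rev t)) 1 by rw [Fin.rev_rev]]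
    exact h
  have hT₁fix : ∀ a : Fin N, a ∉ S → ((T₁ : GL (Fin N) K) : Matrix (Fin N) (Fin N) K) *ᵥ Pi.single a 1 = Pi.single a 1 := fun a ha =>
    lineRoot_mulVec_single_of_ne σ e hstd Han hs het_s _ (hSc a ha) (fun h => ha (h ▸ hsS)) (hetS _ (fun h => ha (by rw [← Fin.rev_rev a]; exact hS _ h)))
  have hT₂fix : ∀ a : Fin N, a ∉ S → ((T₂ : GL (Fin N) K) : Matrix (Fin N) (Fin N) K) *ᵥ Pi.single a 1 = Pi.single a 1 := fun a ha =>
    lineRoot_mulVec_single_of_ne σ e hstd Han hrt hx2_1 _ (hSc a ha) (fun h => ha (h ▸ hrtS)) (hx2S _ (fun h => ha (by rw [← Fin.rev_rev a]; exact hS _ h)))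
  -- the permutations: `τ₁ (rev s) = p`, `τ₂ (rev t) = p`
  have hprev : Fin.rev p ≠ p := rev_ne_of_hyperbolic e hph
  obtain ⟨τ₁, hτ₁, hτ₁p, hτ₁fix⟩ := exists_perm_comm_rev_apply_eq (i₀ := Fin.rev s) (j := p) (by rw [Fin.rev_rev]; exact (rev_ne_of_hyperbolic e hs).symm) hprev
  obtain ⟨τ₂, hτ₂, hτ₂p, hτ₂fix⟩ := exists_perm_comm_rev_apply_eq (i₀ := Fin.rev t) (j := p) (by rw [Fin.rev_rev]; exact (rev_ne_of_hyperbolic e ht).symm) hprev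
  have hτS : ∀ {τ : Equiv.Perm (Fin N)} {c : Fin N}, c ∈ S → (∀ l, l ≠ Fin.rev c → l ≠ Fin.rev (Fin.rev c) → l ≠ p → l ≠ Fin.rev p → τ l = l) →
      ∀ l, l ∉ S → τ l = l := fun {τ c} hc hfix l hl =>
    hfix l (fun h => hl (h ▸ hS c hc)) (fun h => hl (by rw [h, Fin.rev_rev]; exact hc)) (fun h => hl (h ▸ hpS)) (fun h => hl (h ▸ hrpS))
  have hτ₁S : ∀ l, l ∉ S → τ₁ l = l := hτS hsS hτ₁fix
  have hτ₂S : ∀ l, l ∉ S → τ₂ l = l := hτS htS hτ₂fix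
  have hτ₁k : ∀ a : Fin N, r ≤ a.val → a.val < r + m → τ₁ a = a := fun a h₁ h₂ =>
    hτ₁fix a (by rintro rfl; exact absurd hrs (by omega)) (by rintro rfl; rw [Fin.rev_rev] at h₁ h₂; exact absurd hs (by omega))
      (by rintro rfl; exact absurd hph (by omega)) (by rintro rfl; exact absurd (rev_hyperbolic e hph) (by omega))
  have hτ₂k : ∀ a : Fin N, r ≤ a.val → a.val < r + m → τ₂ a = a := fun a h₁ h₂ =>
    hτ₂fix a (by rintro rfl; exact absurd hrt (by omega)) (by rintro rfl; rw [Fin.rev_rev] at h₁ h₂; exact absurd ht (by omega))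
      (by rintro rfl; exact absurd hph (by omega)) (by rintro rfl; exact absurd (rev_hyperbolic e hph) (by omega))
  set P₁ : unitaryGroupOfForm σ (wittFormOn e Han) := ⟨permGL τ₁, permGL_mem_unitary_witt σ e hstd Han hτ₁ hτ₁k⟩ with hP₁
  set P₂ : unitaryGroupOfForm σ (wittFormOn e Han) := ⟨permGL τ₂, permGL_mem_unitary_witt σ e hstd Han hτ₂ hτ₂k⟩ with hP₂
  have hP₁K : P₁ ∈ unitaryInt σ (wittFormOn e Han) := permGL_mem_unitaryInt_witt σ e hstd Han hτ₁ hτ₁k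
  have hP₂K : P₂ ∈ unitaryInt σ (wittFormOn e Han) := permGL_mem_unitaryInt_witt σ e hstd Han hτ₂ hτ₂k
  have hP₁e : ∀ l, ((P₁ : GL (Fin N) K) : Matrix (Fin N) (Fin N) K) *ᵥ Pi.single l 1 = Pi.single (τ₁.symm l) 1 := fun l => permGL_mulVec_single τ₁ l
  have hP₂e : ∀ l, ((P₂ : GL (Fin N) K) : Matrix (Fin N) (Fin N) K) *ᵥ Pi.single l 1 = Pi.single (τ₂.symm l) 1 := fun l => permGL_mulVec_single τ₂ l
  have hτ₁sp : τ₁.symm p = Fin.rev s := by rw [Equiv.symm_apply_eq]; exact hτ₁p.symm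
  have hτ₂sp : τ₂.symm p = Fin.rev t := by rw [Equiv.symm_apply_eq]; exact hτ₂p.symm
  have hτ₁srp : τ₁.symm (Fin.rev p) = s := by rw [perm_symm_rev hτ₁, hτ₁sp, Fin.rev_rev]
  have hτ₂srp : τ₂.symm (Fin.rev p) = t := by rw [perm_symm_rev hτ₂, hτ₂sp, Fin.rev_rev]
  -- `k₁ = P₁⁻¹ T₁⁻¹`, `k₂ = T₂ P₂`
  obtain ⟨k₁, hk₁⟩ : ∃ k₁ : unitaryGroupOfForm σ (wittFormOn e Han), k₁ = P₁⁻¹ * T₁⁻¹ := ⟨_, rfl⟩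
  obtain ⟨k₂, hk₂⟩ : ∃ k₂ : unitaryGroupOfForm σ (wittFormOn e Han), k₂ = T₂ * P₂ := ⟨_, rfl⟩
  have hk₁K : k₁ ∈ unitaryInt σ (wittFormOn e Han) := hk₁ ▸ (unitaryInt σ _).mul_mem ((unitaryInt σ _).inv_mem hP₁K) ((unitaryInt σ _).inv_mem hT₁K)
  have hk₂K : k₂ ∈ unitaryInt σ (wittFormOn e Han) := hk₂ ▸ (unitaryInt σ _).mul_mem hT₂K hP₂K
  have hk₁fix : ∀ a : Fin N, a ∉ S → ((k₁ : GL (Fin N) K) : Matrix (Fin N) (Fin N) K) *ᵥ Pi.single a 1 = Pi.single a 1 := fun a ha => by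
    rw [hk₁, mul_mulVec, Subgroup.coe_inv, Subgroup.coe_inv, inv_mulVec_single_of_mulVec_single T₁ (hT₁fix a ha),
      inv_mulVec_single_of_mulVec_single P₁ (by rw [hP₁e, τ₁.symm_apply_eq.2 (hτ₁S a ha).symm])]
  have hk₂fix : ∀ a : Fin N, a ∉ S → ((k₂ : GL (Fin N) K) : Matrix (Fin N) (Fin N) K) *ᵥ Pi.single a 1 = Pi.single a 1 := fun a ha => by
    rw [hk₂, mul_mulVec, hP₂e, τ₂.symm_apply_eq.2 (hτ₂S a ha).symm, hT₂fix a ha]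
  -- frame stability of `k₁, k₂` and their inverses (eigenvalue `1` on every `e_a`, `a ∉ S`)
  have hfixS : ∀ (κ : unitaryGroupOfForm σ (wittFormOn e Han)), (∀ a : Fin N, a ∉ S → ((κ : GL (Fin N) K) : Matrix (Fin N) (Fin N) K) *ᵥ Pi.single a 1 = Pi.single a 1) →
      (∀ v ∈ frame K N S, ((κ : GL (Fin N) K) : Matrix (Fin N) (Fin N) K) *ᵥ v ∈ frame K N S) ∧
      (∀ v ∈ frame K N S, (((κ : GL (Fin N) K)⁻¹ : GL (Fin N) K) : Matrix (Fin N) (Fin N) K) *ᵥ v ∈ frame K N S) := fun κ hκ =>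
    ⟨fun v hv => mulVec_mem_frame_of_eigen σ e hstd Han κ hS hSc (fun a ha => ⟨1, by rw [one_smul]; exact hκ a ha⟩) hv, fun v hv => by
      have h := mulVec_mem_frame_of_eigen σ e hstd Han κ⁻¹ hS hSc
        (fun a ha => ⟨1, by rw [one_smul, Subgroup.coe_inv]; exact inv_mulVec_single_of_mulVec_single κ (hκ a ha)⟩) hv
      rwa [Subgroup.coe_inv] at h⟩
  refine ⟨k₁, k₂, hk₁K, hk₂K, fun a ha => ⟨hk₁fix a ha, hk₂fix a ha⟩, ?_, ?_, fun a ha b hb => ⟨?_, ?_⟩⟩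
  · -- `q′ e_p = (σλ)⁻¹ e_p`
    have hAx2' : ((q : GL (Fin N) K) : Matrix (Fin N) (Fin N) K) *ᵥ x2 = (σ lam)⁻¹ • Pi.single (Fin.rev s) 1 := hAx2
    rw [hk₁, hk₂]
    simp only [mul_mulVec]
    rw [hP₂e, hτ₂sp, hT₂rt, hAx2', Matrix.mulVec_smul, Matrix.mulVec_smul, Subgroup.coe_inv, Subgroup.coe_inv, inv_mulVec_of_mulVec_eq σ T₁ hT₁rs,
      inv_mulVec_of_mulVec_eq σ P₁ (by rw [hP₁e, hτ₁sp])]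
  · -- `q′ e_{rev p} = λ e_{rev p}`
    have hAet' : ((q : GL (Fin N) K) : Matrix (Fin N) (Fin N) K) *ᵥ Pi.single t 1 = lam • et := hAet
    rw [hk₁, hk₂]
    simp only [mul_mulVec]
    rw [hP₂e, hτ₂srp, hT₂t, hAet', Matrix.mulVec_smul, Matrix.mulVec_smul, Subgroup.coe_inv, Subgroup.coe_inv, inv_mulVec_of_mulVec_eq σ T₁ hT₁s,
      inv_mulVec_of_mulVec_eq σ P₁ (by rw [hP₁e, hτ₁srp])]
  · -- entries of `q′ = k₁ q k₂` on `S × S`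
    rw [Subgroup.coe_mul, Subgroup.coe_mul, Units.val_mul, Units.val_mul]
    exact v_mul_mul_apply_le (mem_unitaryInt_iff.1 hk₁K).1 (fun a ha b hb => (hle a ha b hb).1) (fun v hv => hqS hv)
      (fun b _ => mulVec_mem_stdLattice_of_mem_unitaryInt hk₂K (single_mem_stdLattice b)) (fun b hb => (hfixS k₂ hk₂fix).1 _ (single_mem_frame hb)) hb
  · -- entries of `q′⁻¹ = k₂⁻¹ q⁻¹ k₁⁻¹` on `S × S`
    rw [← Subgroup.coe_inv, _root_.mul_inv_rev, _root_.mul_inv_rev, ← mul_assoc, Subgroup.coe_mul, Subgroup.coe_mul, Units.val_mul, Units.val_mul,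
      Subgroup.coe_inv, Subgroup.coe_inv, Subgroup.coe_inv]
    exact v_mul_mul_apply_le (mem_unitaryInt_iff.1 hk₂K).2 (fun a ha b hb => (hle a ha b hb).2) (fun v hv => hqiS hv)
      (fun b _ => inv_mulVec_mem_stdLattice_of_mem_unitaryInt hk₁K (single_mem_stdLattice b)) (fun b hb => (hfixS k₁ hk₁fix).2 _ (single_mem_frame hb)) hb

end Step

end Summit.HodgeConjecture.HodgeConjecture.Cruxes.H413.K2E3WittCartanStep

end
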